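import Summits.CriticalPhenomena.PercolationContinuityZ3.Theorems.Transplant.FKConnectivityAllQPat3KNetPlaceVee
import HarnessLib

/-!
# Connectivity correlation inequalities for `φ_{w,q}`, every `q > 0` — THEOREM SP(𝒦): the four VEE*-type leaves

Helper file (`--supports stmt-CriticalPhenomena-4575`), census lineage (gen 41) of LANE 2's FK sub-programme; builds on p205010 (kernel
theorem, internal audit signed; external expert review pending).  No definitions, no named facts, no sorries; standard axioms.

Four of the twelve K-state leaf specs of THEOREM SP(𝒦)'s inner bridge branches (census g41 drafts/README) — the ones with a CORNER mark
and two marked slots sharing a vertex — as instances of the generic VEE* placement lemma «Pat3KNetPlaceVee» `FK.placeK_vee` under corner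
relabelings of «Pat3KNetK4Sep» (`k4Sep_of_bridge_par`, `swap_*`): `FK.spGoodC_bridgeLeaf_vee` (type I: corner `c`, `t ∈ Q_xd`,
`b ∈ E₂ = Q_xy`), `_veeY` (pb: corner `x`, `s ∈ Q_yc`, `t ∈ Q_yd`), `_veeC` (pb: corner `x`, `s ∈ Q_yc`, `t ∈ Q_cd`), `_vee3` (pc: corner `c`,
`s ∈ Q_xd`, `t ∈ Q_yd`).  Signatures exactly as consumed by «Pat3KNetSPBridgeI/Pb/PcD2».
[cite: AyyerLinussonRavichandran2025, §7 (p. 22)]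
-/

namespace Summit.CriticalPhenomena.PercolationContinuityZ3.Theorems

namespace FK

open scoped Classical

variable {V : Type*} [Fintype V] {N₀ : Finset (Sym2 V)} {Qac Qad Qbc Qbd Qcd E₂ E C : Finset (Sym2 V)} {x y c d b s t : V}

/-- **LEAF `vee` (type I)**: corner `c`, `t` interior to `Q_xd`, `b` inner in `E₂`. [cite: AyyerLinussonRavichandran2025, §7 (p. 22)] -/
theorem spGoodC_bridgeLeaf_vee
    (ihSP : ∀ {N' E' C' : Finset (Sym2 V)} {x' y' b' s' t' : V}, N'.card < N₀.card → IsKNet N' x' y' → E' ⊆ N' → C' ⊆ N' →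
      (∃ e ∈ N', b' ∈ e) → (∃ e ∈ N', s' ∈ e) → (∃ e ∈ N', t' ∈ e) → b' ≠ s' → b' ≠ t' → s' ≠ t' → SPGoodC E' C' b' s' t')
    (hac : IsKNet Qac x c) (had : IsKNet Qad x d) (hbc : IsKNet Qbc y c) (hbd : IsKNet Qbd y d) (hcd : IsKNet Qcd c d)
    (hsep : BridgeSep Qac Qad Qbc Qbd Qcd x y c d) (h₂ : IsKNet E₂ x y) (hd : Disjoint (Qac ∪ Qad ∪ Qbc ∪ Qbd ∪ Qcd) E₂) (hN : Qac ∪ Qad ∪ Qbc ∪ Qbd ∪ Qcd ∪ E₂ ⊆ N₀)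
    (hV : ∀ z : V, (∃ e ∈ Qac ∪ Qad ∪ Qbc ∪ Qbd ∪ Qcd, z ∈ e) → (∃ e ∈ E₂, z ∈ e) → z = x ∨ z = y)
    (hE : E ⊆ Qac ∪ Qad ∪ Qbc ∪ Qbd ∪ Qcd ∪ E₂) (hC : C ⊆ Qac ∪ Qad ∪ Qbc ∪ Qbd ∪ Qcd ∪ E₂)
    (ht : ∃ e ∈ Qad, t ∈ e) (htx : t ≠ x) (htd : t ≠ d) (hb : ∃ e ∈ E₂, b ∈ e) (hbx : b ≠ x) (hby : b ≠ y) : SPGoodC E C b c t := by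
  have K := (k4Sep_of_bridge_par hac had hbc hbd hsep hd hV).swap_ac.swap_bc
  have eN : Qac ∪ Qad ∪ Qbc ∪ Qbd ∪ Qcd ∪ E₂ = Qac ∪ (Qbc ∪ Qcd ∪ E₂ ∪ Qad ∪ Qbd) := by ac_rfl
  rw [eN] at hN hE hC
  exact (placeK_vee ihSP K hac.symm hbc.symm hcd h₂ had hbd hN hb hbx hby ht htx htd hE hC).swap12

/-- **LEAF `veeY` (pb)**: corner the pole `x`, `s` interior to `Q_yc`, `t` interior to `Q_yd`. [cite: AyyerLinussonRavichandran2025, §7 (p. 22)] -/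
theorem spGoodC_bridgeLeaf_veeY
    (ihSP : ∀ {N' E' C' : Finset (Sym2 V)} {x' y' b' s' t' : V}, N'.card < N₀.card → IsKNet N' x' y' → E' ⊆ N' → C' ⊆ N' →
      (∃ e ∈ N', b' ∈ e) → (∃ e ∈ N', s' ∈ e) → (∃ e ∈ N', t' ∈ e) → b' ≠ s' → b' ≠ t' → s' ≠ t' → SPGoodC E' C' b' s' t')
    (hac : IsKNet Qac x c) (had : IsKNet Qad x d) (hbc : IsKNet Qbc y c) (hbd : IsKNet Qbd y d) (hcd : IsKNet Qcd c d)
    (hsep : BridgeSep Qac Qad Qbc Qbd Qcd x y c d) (h₂ : IsKNet E₂ x y) (hd : Disjoint (Qac ∪ Qad ∪ Qbc ∪ Qbd ∪ Qcd) E₂) (hN : Qac ∪ Qad ∪ Qbc ∪ Qbd ∪ Qcd ∪ E₂ ⊆ N₀)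
    (hV : ∀ z : V, (∃ e ∈ Qac ∪ Qad ∪ Qbc ∪ Qbd ∪ Qcd, z ∈ e) → (∃ e ∈ E₂, z ∈ e) → z = x ∨ z = y)
    (hE : E ⊆ Qac ∪ Qad ∪ Qbc ∪ Qbd ∪ Qcd ∪ E₂) (hC : C ⊆ Qac ∪ Qad ∪ Qbc ∪ Qbd ∪ Qcd ∪ E₂)
    (hs : ∃ e ∈ Qbc, s ∈ e) (hsy : s ≠ y) (hsc : s ≠ c) (ht : ∃ e ∈ Qbd, t ∈ e) (hty : t ≠ y) (htd : t ≠ d) : SPGoodC E C x s t := by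
  have K := k4Sep_of_bridge_par hac had hbc hbd hsep hd hV
  have eN : Qac ∪ Qad ∪ Qbc ∪ Qbd ∪ Qcd ∪ E₂ = E₂ ∪ (Qac ∪ Qad ∪ Qbc ∪ Qbd ∪ Qcd) := by ac_rfl
  rw [eN] at hN hE hC
  exact placeK_vee ihSP K h₂ hac had hbc hbd hcd hN hs hsy hsc ht hty htd hE hC

/-- **LEAF `veeC` (pb)**: corner the pole `x`, `s` interior to `Q_yc`, `t` interior to `Q_cd`. [cite: AyyerLinussonRavichandran2025, §7 (p. 22)] -/
theorem spGoodC_bridgeLeaf_veeC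
    (ihSP : ∀ {N' E' C' : Finset (Sym2 V)} {x' y' b' s' t' : V}, N'.card < N₀.card → IsKNet N' x' y' → E' ⊆ N' → C' ⊆ N' →
      (∃ e ∈ N', b' ∈ e) → (∃ e ∈ N', s' ∈ e) → (∃ e ∈ N', t' ∈ e) → b' ≠ s' → b' ≠ t' → s' ≠ t' → SPGoodC E' C' b' s' t')
    (hac : IsKNet Qac x c) (had : IsKNet Qad x d) (hbc : IsKNet Qbc y c) (hbd : IsKNet Qbd y d) (hcd : IsKNet Qcd c d)
    (hsep : BridgeSep Qac Qad Qbc Qbd Qcd x y c d) (h₂ : IsKNet E₂ x y) (hd : Disjoint (Qac ∪ Qad ∪ Qbc ∪ Qbd ∪ Qcd) E₂) (hN : Qac ∪ Qad ∪ Qbc ∪ Qbd ∪ Qcd ∪ E₂ ⊆ N₀)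
    (hV : ∀ z : V, (∃ e ∈ Qac ∪ Qad ∪ Qbc ∪ Qbd ∪ Qcd, z ∈ e) → (∃ e ∈ E₂, z ∈ e) → z = x ∨ z = y)
    (hE : E ⊆ Qac ∪ Qad ∪ Qbc ∪ Qbd ∪ Qcd ∪ E₂) (hC : C ⊆ Qac ∪ Qad ∪ Qbc ∪ Qbd ∪ Qcd ∪ E₂)
    (hs : ∃ e ∈ Qbc, s ∈ e) (hsy : s ≠ y) (hsc : s ≠ c) (ht : ∃ e ∈ Qcd, t ∈ e) (htc : t ≠ c) (htd : t ≠ d) : SPGoodC E C x s t := by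
  have K := (k4Sep_of_bridge_par hac had hbc hbd hsep hd hV).swap_bc
  have eN : Qac ∪ Qad ∪ Qbc ∪ Qbd ∪ Qcd ∪ E₂ = Qac ∪ (E₂ ∪ Qad ∪ Qbc ∪ Qcd ∪ Qbd) := by ac_rfl
  rw [eN] at hN hE hC
  exact placeK_vee ihSP K hac h₂ had hbc.symm hcd hbd hN hs hsc hsy ht htc htd hE hC

/-- **LEAF `vee3` (pc)**: corner `c`, `s` interior to `Q_xd`, `t` interior to `Q_yd`. [cite: AyyerLinussonRavichandran2025, §7 (p. 22)] -/
theorem spGoodC_bridgeLeaf_vee3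
    (ihSP : ∀ {N' E' C' : Finset (Sym2 V)} {x' y' b' s' t' : V}, N'.card < N₀.card → IsKNet N' x' y' → E' ⊆ N' → C' ⊆ N' →
      (∃ e ∈ N', b' ∈ e) → (∃ e ∈ N', s' ∈ e) → (∃ e ∈ N', t' ∈ e) → b' ≠ s' → b' ≠ t' → s' ≠ t' → SPGoodC E' C' b' s' t')
    (hac : IsKNet Qac x c) (had : IsKNet Qad x d) (hbc : IsKNet Qbc y c) (hbd : IsKNet Qbd y d) (hcd : IsKNet Qcd c d)
    (hsep : BridgeSep Qac Qad Qbc Qbd Qcd x y c d) (h₂ : IsKNet E₂ x y) (hd : Disjoint (Qac ∪ Qad ∪ Qbc ∪ Qbd ∪ Qcd) E₂) (hN : Qac ∪ Qad ∪ Qbc ∪ Qbd ∪ Qcd ∪ E₂ ⊆ N₀)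
    (hV : ∀ z : V, (∃ e ∈ Qac ∪ Qad ∪ Qbc ∪ Qbd ∪ Qcd, z ∈ e) → (∃ e ∈ E₂, z ∈ e) → z = x ∨ z = y)
    (hE : E ⊆ Qac ∪ Qad ∪ Qbc ∪ Qbd ∪ Qcd ∪ E₂) (hC : C ⊆ Qac ∪ Qad ∪ Qbc ∪ Qbd ∪ Qcd ∪ E₂)
    (hs : ∃ e ∈ Qad, s ∈ e) (hsx : s ≠ x) (hsd : s ≠ d) (ht : ∃ e ∈ Qbd, t ∈ e) (hty : t ≠ y) (htd : t ≠ d) : SPGoodC E C c s t := by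
  have K := (k4Sep_of_bridge_par hac had hbc hbd hsep hd hV).swap_ac.swap_cd.swap_bc
  have eN : Qac ∪ Qad ∪ Qbc ∪ Qbd ∪ Qcd ∪ E₂ = Qcd ∪ (Qbc ∪ Qac ∪ Qbd ∪ Qad ∪ E₂) := by ac_rfl
  rw [eN] at hN hE hC
  exact (placeK_vee ihSP K hcd hbc.symm hac.symm hbd.symm had.symm h₂.symm hN ht htd hty hs hsd hsx hE hC).swap23

end FK

end Summit.CriticalPhenomena.PercolationContinuityZ3.Theorems
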